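import Mathlib
import Summits.NavierStokesRegularity.NavierStokesRegularity.Theorems.TaoLadderRungTwoFlatCertificateGlueCertificateFinalGenOn
import HarnessLib

/-!
# Certificate glue on a shift set `𝕊`, XXXVII-c: INSTANCE KIT for the E3 certificate — three small lemmas an instance of glue XXXVII-b
  `stub_rung_quarter_of_certificateE3` needs and no checker provides (helper for item stmt-NavierStokesRegularity-22987 `FlatGapCertificatesV2` (crux K_A♭ of
  route TaoLadderRungTwoFlat); cell harvest/h2-tao-ladder, p1 g17; referee c78 P167, acting-lead ask (ii) on per-step files)

* `omega_pos_of_tableE3` (P167): the hypothesis `hω : ∀ bb i k, 0 < ωq bb i k` is tested by NO checker (`checkRefBox` divides by `ωq` without a sign test);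
  for a branch weight `ωq i k = if −36 ≤ k ≤ 12 then ωtab[(k+36) + 49 i] else 1` it follows from the Boolean `ωtab.all (0 < ·)` and `ωtab.size = 98`.
* `checkStepG_congr`: `checkStepG … rec j` reads ONLY `rec j` and `rec (j+1)` — so a per-step file may evaluate it on a two-record function and the assembly
  transports the Boolean to the branch's full record function (the per-step files cannot hold all records: ≈ 130 MB of literals for the certificate of record).
* `forall_lt_of_all_range`: unpacking a `List.range` conjunction (`checkTransit` / `checkStepG` stated as ONE Boolean per branch).

HONEST FRAMING: bookkeeping lemmas for the Tao-type MODEL lattice certificate format; nothing is certified here, no stub is closed, nothing here is a statement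
about the Navier–Stokes equations.
-/

-- the sub-problem namespace repeats the summit name by design (D-0017)
set_option linter.dupNamespace false

namespace Summit.NavierStokesRegularity.NavierStokesRegularity.Theorems

open Summit.NavierStokesRegularity.NavierStokesRegularity.Theorems.TaylorModelCert

namespace CertificateGlueOn

/-- **P167 discharge pattern**: a window weight table (`Kb = 36`, `Ka = 12`, stride `49`, `98` entries) read through `dgetD`, with `1` off the window, is
positive everywhere once every table entry is positive. [folklore] -/
theorem omega_pos_of_tableE3 (ωtab : Array Dyad) (hsz : ωtab.size = 98)
    (hall : (ωtab.all fun d => decide (0 < dyadToRat d)) = true) (i : Fin 2) (k : ℤ) :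
    0 < (if -36 ≤ k ∧ k ≤ 12 then dyadToRat (dgetD ωtab ((k + 36).toNat + 49 * i.val)) else 1) := by
  split_ifs with h
  · have hidx : (k + 36).toNat + 49 * i.val < ωtab.size := by rw [hsz]; have := i.isLt; omega
    rw [Array.all_eq_true] at hall
    have := hall ((k + 36).toNat + 49 * i.val) hidx
    simp only [decide_eq_true_eq] at this
    unfold dgetD; rw [dif_pos hidx]; exact this
  · norm_num

/-- **Locality of the step test**: `checkStepG … rec j` depends on `rec` only through `rec j` and `rec (j+1)`. [folklore] -/
theorem checkStepG_congr {m : ℕ} {Kb Ka : ℤ} {prec p kexp nexp : ℕ} {shifts : List (ℤ × ℤ × ℤ)}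
    {cB : Fin m → ℤ → Fin m → Fin m → ℤ × ℤ × ℤ → IntervalD} {αq : Fin m → Fin m → Fin m → ℤ × ℤ × ℤ → ℚ} {ωq : Fin m → ℤ → ℚ}
    {Sp Sm : IntervalD} {bD : Dyad} {Eb Et : ℚ} {rec rec' : ℕ → VRec} {j : ℕ} (hj : rec j = rec' j) (hj1 : rec (j + 1) = rec' (j + 1)) :
    checkStepG m Kb Ka prec p kexp nexp shifts cB αq ωq Sp Sm bD Eb Et rec j =
      checkStepG m Kb Ka prec p kexp nexp shifts cB αq ωq Sp Sm bD Eb Et rec' j := by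
  simp only [checkStepG, hj, hj1]

/-- Unpacking a `List.range` conjunction of Booleans. [folklore] -/
theorem forall_lt_of_all_range {N : ℕ} {f : ℕ → Bool} (h : ((List.range N).all f) = true) : ∀ j, j < N → f j = true := by
  intro j hj
  rw [List.all_eq_true] at h
  exact h j (List.mem_range.mpr hj)

end CertificateGlueOn

end Summit.NavierStokesRegularity.NavierStokesRegularity.Theorems
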